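import Summits.AtomisticToContinuum.BoseEinsteinCondensation.Theorems.BECGroundStateSOSPeriodicIRBoundWFHeartKin
import Literature.MathematicalPhysics.QuantumManyBody.TorusFockSectorDictionary
import Literature.MathematicalPhysics.QuantumManyBody.TorusFockSectorInteraction
import Literature.MathematicalPhysics.QuantumManyBody.TorusFockLayer
import HarnessLib

/-!
# Crux `RichardsonAnchorBEC` (stmt-AtomisticToContinuum-14805), route `BECRichardsonGaudin`, line `registered` —
# stub `stub_modeAnSectorWave`: the annihilation operator of a plane wave on a sector wave function

For a finite set of modes `ι` with injective momentum labels `e : ι → ℤ³` and a sector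
`A ∈ ℂ[X_ι]`, the first-quantised annihilation operator `a(φ_q)` of the normalised smooth plane
wave `φ_q = planeWaveMode L q` (`modeAn`, [LSSY2005, (A.13)]) acts on the `(n+1)`-body sector wave
function `Ψ_A = sectorWave L e A (n+1)` of `TorusFockSectorDictionary` by
* `a(φ_{e p}) Ψ_A = √(L³) · Ψ_{∂_p A}` for a mode `q = e p` (the factor `√(L³)` because the plane
  waves inside `sectorWave` are unnormalised), and
* `a(φ_q) Ψ_A = 0` for `q ∉ range e`.

Proof: split the plane-wave product at the contracted slot (`Fin.prod_univ_succ`), exchange the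
finite word sum and the cell integral, use the one-particle orthogonality
`∫_Λ conj(φ_q) e_p = √(L³)[q = p]` (`integral_cell_conj_planeWaveMode_mul_cellWave`, from
`integral_cell_cellWave_mul_cellWave`), reindex the surviving words `k = p :: k'`
(`Fin.consEquiv`) and use the annihilation recursion `Fock.amp_cons`
(`ψ̃_A(p :: k') = (n+1)^{-1/2} ψ̃_{∂_pA}(k')`), whose prefactor cancels the `√(n+1)` of `modeAn`.
-/

noncomputable section

open MeasureTheory Filter
open scoped ENNReal NNReal ComplexConjugate BigOperators

namespace Summit.AtomisticToContinuum.BoseEinsteinCondensation.Cruxes.RichardsonAnchorBEC.Birth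

open Literature.MathematicalPhysics.QuantumManyBody.BoseGas
open Summit.AtomisticToContinuum.BoseEinsteinCondensation.Cruxes.PeriodicIRBound.LinearPhFloorWagner.WF
open MvPolynomial

/-- **One-particle orthogonality against an unnormalised plane wave**:
`∫_Λ conj(φ_q) e_p = √(L³) · [q = p]`. [folklore] -/
theorem integral_cell_conj_planeWaveMode_mul_cellWave {L : ℝ} (hL : 0 < L) (q p : Momentum) :
    ∫ x in cell L, conj (planeWaveMode L q x) * cellWave L p x =
      if q = p then ((Real.sqrt (L ^ 3) : ℝ) : ℂ) else 0 := by
  have hpt : ∀ x, conj (planeWaveMode L q x) * cellWave L p x =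
      ((Real.sqrt (L ^ 3))⁻¹ : ℂ) * (cellWave L (-q) x * cellWave L p x) := by
    intro x
    rw [planeWaveMode_eq, map_mul, ← Complex.ofReal_inv, Complex.conj_ofReal, Complex.ofReal_inv,
      conj_cellWave]
    ring
  simp_rw [hpt]
  rw [integral_const_mul, integral_cell_cellWave_mul_cellWave hL]
  by_cases hqp : q = p
  · subst hqp
    rw [if_pos (neg_add_cancel q), if_pos rfl]
    have h3 : (0 : ℝ) ≤ L ^ 3 := by positivity
    have hs : ((Real.sqrt (L ^ 3) : ℝ) : ℂ) ≠ 0 :=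
      Complex.ofReal_ne_zero.2 (Real.sqrt_pos.2 (by positivity)).ne'
    have hL3 : ((L : ℂ) ^ 3) = ((Real.sqrt (L ^ 3) : ℝ) : ℂ) * ((Real.sqrt (L ^ 3) : ℝ) : ℂ) := by
      rw [← Complex.ofReal_mul, Real.mul_self_sqrt h3]
      push_cast
      ring
    rw [hL3, ← mul_assoc, inv_mul_cancel₀ hs, one_mul]
  · have hne : ¬(-q + p = 0) := fun h => hqp (neg_add_eq_zero.1 h)
    rw [if_neg hne, if_neg hqp, mul_zero]

/-- **`a(φ_q)` on a sector wave function, word by word**: contracting the first slot of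
`Ψ_A(x, Y) = ∑_k ψ̃_A(k) e_{e(k₀)}(x) ∏_{i ≥ 1} e_{e(kᵢ)}(Yᵢ)` against `conj(φ_q)` leaves
`√(n+1) ∑_k ψ̃_A(k) √(L³)[q = e(k₀)] ∏_{i ≥ 1} e_{e(kᵢ)}(Yᵢ)`. [cite: LSSY2005, App. A (A.13)] -/
theorem modeAn_planeWaveMode_sectorWave_apply {ι : Type} [Fintype ι] {L : ℝ} (hL : 0 < L)
    (e : ι → Momentum) (q : Momentum) (A : MvPolynomial ι ℂ) (n : ℕ) (Y : Config n) :
    modeAn L (planeWaveMode L q) (sectorWave L e A (n + 1)) Y =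
      ((Real.sqrt (n + 1) : ℝ) : ℂ) * ∑ k : Fin (n + 1) → ι,
        Fock.amp A (n + 1) k * (if q = e (k 0) then ((Real.sqrt (L ^ 3) : ℝ) : ℂ) else 0) *
          ∏ i : Fin n, cellWave L (e (k i.succ)) (Y i) := by
  rw [modeAn_apply]
  congr 1
  have hexp : ∀ x : Space,
      conj (planeWaveMode L q x) * sectorWave L e A (n + 1) (Matrix.vecCons x Y) =
        ∑ k : Fin (n + 1) → ι, Fock.amp A (n + 1) k *
          (conj (planeWaveMode L q x) * cellWave L (e (k 0)) x) *
            ∏ i : Fin n, cellWave L (e (k i.succ)) (Y i) := by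
    intro x
    unfold sectorWave
    rw [Finset.mul_sum]
    refine Finset.sum_congr rfl fun k _ => ?_
    rw [Fin.prod_univ_succ]
    simp only [Matrix.cons_val_zero, Matrix.cons_val_succ]
    ring
  simp_rw [hexp]
  have hint : ∀ k : Fin (n + 1) → ι, IntegrableOn (fun x : Space => Fock.amp A (n + 1) k *
      (conj (planeWaveMode L q x) * cellWave L (e (k 0)) x) *
        ∏ i : Fin n, cellWave L (e (k i.succ)) (Y i)) (cell L) := by
    intro k
    have hc : Continuous fun x : Space => conj (planeWaveMode L q x) * cellWave L (e (k 0)) x :=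
      (Complex.continuous_conj.comp (continuous_planeWaveMode L q)).mul (continuous_cellWave L _)
    exact Integrable.mul_const (Integrable.const_mul (integrableOn_cell hc) _) _
  rw [integral_finsetSum _ fun k _ => hint k]
  refine Finset.sum_congr rfl fun k _ => ?_
  rw [integral_mul_const, integral_const_mul, integral_cell_conj_planeWaveMode_mul_cellWave hL]

/-- **The annihilation operator of a plane wave on a sector wave function**
(the dictionary `a_p ↔ ∂_p` of [LSSY2005, App. A] in first quantisation): for injective mode
labels `e`, (i) `a(φ_{e p}) Ψ_A^{(n+1)} = √(L³) · Ψ^{(n)}_{∂_p A}` for every mode `p`, and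
(ii) `a(φ_q) Ψ_A^{(n+1)} = 0` for every momentum `q` outside the mode set.
[cite: LSSY2005, App. A (A.13)] -/
theorem stub_modeAnSectorWave :
    ∀ {ι : Type} [Fintype ι] [DecidableEq ι] (L : ℝ) (e : ι → Momentum) (A : MvPolynomial ι ℂ) (n : ℕ),
      0 < L → Function.Injective e →
      (∀ p : ι, modeAn L (planeWaveMode L (e p)) (sectorWave L e A (n + 1)) =
          fun Y => ((Real.sqrt (L ^ 3) : ℝ) : ℂ) * sectorWave L e (MvPolynomial.pderiv p A) n Y) ∧
      (∀ m : Momentum, m ∉ Set.range e →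
          modeAn L (planeWaveMode L m) (sectorWave L e A (n + 1)) = fun _ => 0) := by
  intro ι _ _ L e A n hL he
  refine ⟨fun p => ?_, fun m hm => ?_⟩
  · funext Y
    rw [modeAn_planeWaveMode_sectorWave_apply hL]
    -- reindex the words `k = a :: k'`
    rw [← (Fin.consEquiv fun _ : Fin (n + 1) => ι).sum_comp, Fintype.sum_prod_type]
    have hcons : ∀ (a : ι) (k : Fin n → ι),
        (Fin.consEquiv fun _ : Fin (n + 1) => ι) (a, k) = Fin.cons a k := fun _ _ => rfl
    have hinj : ∀ a : ι, (e p = e a) = (p = a) := fun a => propext he.eq_iff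
    simp only [hcons, Fin.cons_zero, Fin.cons_succ, Fock.amp_cons, hinj]
    rw [Finset.sum_eq_single p]
    · simp only [ite_true]
      unfold sectorWave
      rw [Finset.mul_sum, Finset.mul_sum]
      refine Finset.sum_congr rfl fun k _ => ?_
      have hc : ((Real.sqrt ((n : ℝ) + 1) : ℝ) : ℂ) * (((Real.sqrt ((n : ℝ) + 1))⁻¹ : ℝ) : ℂ) = 1 := by
        rw [← Complex.ofReal_mul, mul_inv_cancel₀ (Real.sqrt_pos.2 (by positivity)).ne',
          Complex.ofReal_one]
      calc _ = ((Real.sqrt ((n : ℝ) + 1) : ℝ) : ℂ) * (((Real.sqrt ((n : ℝ) + 1))⁻¹ : ℝ) : ℂ) *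
            (((Real.sqrt (L ^ 3) : ℝ) : ℂ) *
              (Fock.amp (pderiv p A) n k * ∏ i, cellWave L (e (k i)) (Y i))) := by ring
        _ = _ := by rw [hc, one_mul]
    · intro a _ hap
      simp only [if_neg (Ne.symm hap), mul_zero, zero_mul, Finset.sum_const_zero]
    · intro h
      exact absurd (Finset.mem_univ p) h
  · funext Y
    rw [modeAn_planeWaveMode_sectorWave_apply hL]
    have hk : ∀ k : Fin (n + 1) → ι, ¬(m = e (k 0)) := fun k h => hm ⟨k 0, h.symm⟩
    simp only [hk, ite_false, mul_zero, zero_mul, Finset.sum_const_zero]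

end Summit.AtomisticToContinuum.BoseEinsteinCondensation.Cruxes.RichardsonAnchorBEC.Birth

end
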